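import Literature.Geometry.Kaehler.ComplexTorus
import Mathlib.Geometry.Manifold.ContMDiff.Atlas
import Mathlib.Topology.Algebra.Module.FiniteDimension
import HarnessLib

/-!
# Holomorphic maps of complex tori: translations and homomorphisms

Companion of `Literature/Geometry/Kaehler/ComplexTorus.lean`. For complex tori
`X = E/Φ(ℤ^ι)`, `X' = E'/Φ'(ℤ^ι')` (`ComplexTorus Φ`, `ComplexTorus Φ'`):

* `ComplexTorus.contMDiff_of_lift`: a map `F : X → X'` admitting a lift `G : E → E'` to the
  universal covers (`F ∘ π = π' ∘ G`) which is `C^n` over `𝕜 ∈ {ℝ, ℂ}` is a `C^n` map of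
  manifolds over `𝕜` — in the charts `F` reads `(translation) ∘ G` (Lange–Birkenhake (1992),
  §1.1.2, proof of Prop. 1.1.6: holomorphic maps of tori are studied through their lifts
  `F̃ : V → V'` to the universal covers);
* `ComplexTorus.contMDiff_add_const`: translations `t_s : x ↦ x + s` are biholomorphic
  (Lange–Birkenhake (1992), §1.1.2: "The translation `t_{x₀}` … is also holomorphic");
* `ComplexTorus.mapMatrix A : X → X'`, the homomorphism `x ↦ A x` induced by an integer matrix
  `A ∈ M(ι' × ι, ℤ)` (in the lattice coordinates; `ComplexTorus.mapMatrix_proj`: its lift is the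
  real-linear map `A_ℝ`), which is always real `C^∞` (`contMDiff_real_mapMatrix`) and is
  holomorphic as soon as its *analytic representation* `Φ' ∘ A_ℝ ∘ Φ⁻¹ : E → E'` is `ℂ`-linear
  (`contMDiff_mapMatrix`; Lange–Birkenhake (1992), §1.1.2, Prop. 1.1.6 ff.: a homomorphism
  `f : X → X'` is given by a `ℂ`-linear `ρₐ(f) : V → V'` with `ρₐ(f)(Λ) ⊆ Λ'`, whose matrix in
  lattice bases is the integral *rational representation* `ρᵣ(f)`).

## Not here

The converse statements of Lange–Birkenhake §1.1.2 (every holomorphic map is a translate of a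
homomorphism, Prop. 1.1.6; injectivity of `ρₐ`, `ρᵣ`), isogenies, kernels and images.

## References

* H. Lange, Ch. Birkenhake, *Complex Abelian Varieties*, Grundlehren 302 (1992), §1.1.2
  (homomorphisms, translations, analytic and rational representations). [LangeBirkenhake1992]
-/

noncomputable section

open scoped Manifold ContDiff Topology
open Set Filter

namespace Literature.Geometry.Kaehler

namespace ComplexTorus

variable {ι ι' : Type*}
  {E E' : Type*} [NormedAddCommGroup E] [NormedSpace ℂ E] [NormedAddCommGroup E'] [NormedSpace ℂ E']
  {Φ : (ι → ℝ) ≃L[ℝ] E} {Φ' : (ι' → ℝ) ≃L[ℝ] E'}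

/-! ### Maps with a lift to the universal covers -/

section Lift

variable [Fintype ι]

/-- A map of complex tori admitting a continuous lift `G` to the universal covers
(`F (π z) = π' (G z)`, `π = proj ∘ Φ⁻¹`) is continuous: over the domain of each chart `φ` it is
`π' ∘ G ∘ φ`. Lange–Birkenhake (1992), §1.1.2 (lifts `F̃ : V → V'`). [cite: LangeBirkenhake1992, §1.1.2] -/
theorem continuous_of_lift {F : ComplexTorus Φ → ComplexTorus Φ'} {G : E → E'} (hG : Continuous G)
    (h : ∀ z, F (proj Φ (Φ.symm z)) = proj Φ' (Φ'.symm (G z))) : Continuous F := by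
  refine continuous_iff_continuousAt.2 fun t ↦ ?_
  have heq : (fun s ↦ proj Φ' (Φ'.symm (G (chartAt E t s)))) =ᶠ[𝓝 t] F := by
    filter_upwards [(chartAt E t).open_source.mem_nhds (mem_chart_source E t)] with s hs
    rw [← h, chartAt_eq, ← chart_symm_apply Φ (corner Φ t), (chart Φ (corner Φ t)).left_inv hs]
  refine ContinuousAt.congr ?_ heq
  exact ((continuous_proj Φ').comp (Φ'.symm.continuous.comp hG)).continuousAt.comp
    ((chartAt E t).continuousAt (mem_chart_source E t))

variable [Fintype ι']

/-- **A lifted map, written in the preferred charts, is a lattice translate of its lift**: if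
`F (π z) = π' (G z)` with `G` continuous, then near the centre of the chart at `x` the map
`writtenInExtChartAt x F = (chart at F x) ∘ F ∘ (chart at x)⁻¹` is `w ↦ G w - c` for a constant
`c` (`= Φ'(n)`, `n ∈ ℤ^ι'`; `ComplexTorus.eventuallyEq_chart_symm_trans`). Lange–Birkenhake
(1992), §1.1.2 (maps of tori through their lifts `F̃ : V → V'`). [cite: LangeBirkenhake1992, §1.1.2] -/
theorem writtenInExtChartAt_eventuallyEq_of_lift {𝕜 : Type*} [NontriviallyNormedField 𝕜]
    [NormedSpace 𝕜 E] [NormedSpace 𝕜 E'] {F : ComplexTorus Φ → ComplexTorus Φ'} {G : E → E'}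
    (hG : Continuous G) (h : ∀ z, F (proj Φ (Φ.symm z)) = proj Φ' (Φ'.symm (G z)))
    (x : ComplexTorus Φ) :
    ∃ c : E', writtenInExtChartAt 𝓘(𝕜, E) 𝓘(𝕜, E') x F =ᶠ[𝓝 (extChartAt 𝓘(𝕜, E) x x)]
      fun w ↦ G w - c := by
  have hpt : extChartAt 𝓘(𝕜, E) x x = chart Φ (corner Φ x) x := by simp [chartAt_eq]
  have hF : F (proj Φ (Φ.symm (chart Φ (corner Φ x) x))) ∈ (chart Φ' (corner Φ' (F x))).source := by
    rw [proj_symm_chart Φ (by rw [← chartAt_eq]; exact mem_chart_source E x), ← chartAt_eq]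
    exact mem_chart_source E' (F x)
  rw [h, chart_source] at hF
  have hfun : writtenInExtChartAt 𝓘(𝕜, E) 𝓘(𝕜, E') x F =
      fun w ↦ chart Φ' (corner Φ' (F x)) ((chart Φ' (corner Φ' (F x))).symm (G w)) := by
    funext w
    simp [writtenInExtChartAt, chartAt_eq, h]
  refine ⟨Φ' (fun i ↦ (toIcoDiv zero_lt_one (corner Φ' (F x) i)
    (Φ'.symm (G (chart Φ (corner Φ x) x)) i) : ℝ)), ?_⟩
  rw [hfun, hpt]
  exact (eventuallyEq_chart_symm_trans Φ' hF (corner Φ' (F x))).comp_tendsto hG.continuousAt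

/-- **Maps of complex tori with a `C^n` lift are `C^n`.** If `F : E/Φ(ℤ^ι) → E'/Φ'(ℤ^ι')`
satisfies `F (π z) = π' (G z)` for a map `G : E → E'` which is `C^n` over `𝕜` (`𝕜 = ℂ`:
holomorphic; `𝕜 = ℝ`: real `C^n`), then `F` is `C^n` as a map of manifolds modelled on
`𝓘(𝕜, E)`, `𝓘(𝕜, E')` (in the charts it is a lattice translate of `G`,
`writtenInExtChartAt_eventuallyEq_of_lift`). Lange–Birkenhake (1992), §1.1.2 (a map of tori is
holomorphic iff its lift to the universal covers is). [cite: LangeBirkenhake1992, §1.1.2] -/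
theorem contMDiff_of_lift {𝕜 : Type*} [NontriviallyNormedField 𝕜] [NormedSpace 𝕜 E]
    [NormedSpace 𝕜 E'] {n : WithTop ℕ∞} {F : ComplexTorus Φ → ComplexTorus Φ'} {G : E → E'}
    (hG : ContDiff 𝕜 n G) (h : ∀ z, F (proj Φ (Φ.symm z)) = proj Φ' (Φ'.symm (G z))) :
    ContMDiff 𝓘(𝕜, E) 𝓘(𝕜, E') n F := by
  intro x
  refine contMDiffAt_iff.2 ⟨(continuous_of_lift hG.continuous h).continuousAt, ?_⟩
  obtain ⟨c, hc⟩ := writtenInExtChartAt_eventuallyEq_of_lift (𝕜 := 𝕜) hG.continuous h x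
  exact ((hG.contDiffAt.sub contDiffAt_const).congr_of_eventuallyEq hc).contDiffWithinAt

/-- **The derivative of a lifted map is the derivative of its lift**: if `F (π z) = π' (G z)`
with `G` differentiable over `𝕜`, then `F` has at `x` the manifold derivative
`dG (φₓ x)` (`φₓ` the preferred chart at `x`; the tangent spaces of both tori being identified
with `E`, `E'` by their canonical trivialisations — complex tori are parallelizable, Huybrechts
(2005), Exercise 2.2.15). Lange–Birkenhake (1992), §1.1.2 (the analytic representation as the
differential). [cite: LangeBirkenhake1992, §1.1.2] -/
theorem hasMFDerivAt_of_lift {𝕜 : Type*} [NontriviallyNormedField 𝕜] [NormedSpace 𝕜 E]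
    [NormedSpace 𝕜 E'] {F : ComplexTorus Φ → ComplexTorus Φ'} {G : E → E'}
    (hG : Differentiable 𝕜 G) (h : ∀ z, F (proj Φ (Φ.symm z)) = proj Φ' (Φ'.symm (G z)))
    (x : ComplexTorus Φ) :
    HasMFDerivAt 𝓘(𝕜, E) 𝓘(𝕜, E') F x (fderiv 𝕜 G (extChartAt 𝓘(𝕜, E) x x)) := by
  refine ⟨(continuous_of_lift hG.continuous h).continuousAt, ?_⟩
  obtain ⟨c, hc⟩ := writtenInExtChartAt_eventuallyEq_of_lift (𝕜 := 𝕜) hG.continuous h x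
  exact (((hG _).hasFDerivAt.sub_const c).congr_of_eventuallyEq hc).hasFDerivWithinAt

/-- The manifold derivative of a lifted map is the derivative of its lift (`mfderiv` form of
`hasMFDerivAt_of_lift`). [cite: LangeBirkenhake1992, §1.1.2] -/
theorem mfderiv_of_lift {𝕜 : Type*} [NontriviallyNormedField 𝕜] [NormedSpace 𝕜 E]
    [NormedSpace 𝕜 E'] {F : ComplexTorus Φ → ComplexTorus Φ'} {G : E → E'}
    (hG : Differentiable 𝕜 G) (h : ∀ z, F (proj Φ (Φ.symm z)) = proj Φ' (Φ'.symm (G z)))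
    (x : ComplexTorus Φ) :
    mfderiv 𝓘(𝕜, E) 𝓘(𝕜, E') F x = fderiv 𝕜 G (extChartAt 𝓘(𝕜, E) x x) :=
  (hasMFDerivAt_of_lift hG h x).mfderiv

end Lift

/-! ### Translations -/

/-- `proj` is additive. [folklore] -/
theorem proj_add (x y : ι → ℝ) : proj Φ (x + y) = proj Φ x + proj Φ y :=
  rfl

section Translations

variable [Fintype ι]

/-- **Translations of a complex torus are biholomorphic** (`C^n` over `𝕜 ∈ {ℝ, ℂ}` for every
`n`; the inverse is the translation by `-s`): the lift of `x ↦ x + s` is `z ↦ z + Φ(s̃)` for a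
lift `s̃` of `s`. Lange–Birkenhake (1992), §1.1.2 ("The translation `t_{x₀}` … is also
holomorphic"). [cite: LangeBirkenhake1992, §1.1.2] -/
theorem contMDiff_add_const {𝕜 : Type*} [NontriviallyNormedField 𝕜] [NormedSpace 𝕜 E]
    {n : WithTop ℕ∞} (s : ComplexTorus Φ) :
    ContMDiff 𝓘(𝕜, E) 𝓘(𝕜, E) n (fun x : ComplexTorus Φ ↦ x + s) :=
  contMDiff_of_lift (G := fun z ↦ z + Φ (lift Φ s)) (contDiff_id.add contDiff_const) fun z ↦ by
    rw [map_add, ContinuousLinearEquiv.symm_apply_apply, proj_add, proj_lift]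

/-- Translations `x ↦ s + x` are biholomorphic. [cite: LangeBirkenhake1992, §1.1.2] -/
theorem contMDiff_const_add {𝕜 : Type*} [NontriviallyNormedField 𝕜] [NormedSpace 𝕜 E]
    {n : WithTop ℕ∞} (s : ComplexTorus Φ) :
    ContMDiff 𝓘(𝕜, E) 𝓘(𝕜, E) n (fun x : ComplexTorus Φ ↦ s + x) := by
  simp_rw [add_comm s]
  exact contMDiff_add_const s

/-- Negation `x ↦ -x` is biholomorphic (lift `z ↦ -z`). Lange–Birkenhake (1992), §1.1.2
(the homomorphism `-1_X`). [cite: LangeBirkenhake1992, §1.1.2] -/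
theorem contMDiff_neg {𝕜 : Type*} [NontriviallyNormedField 𝕜] [NormedSpace 𝕜 E]
    {n : WithTop ℕ∞} :
    ContMDiff 𝓘(𝕜, E) 𝓘(𝕜, E) n (fun x : ComplexTorus Φ ↦ -x) :=
  contMDiff_of_lift (G := fun z ↦ -z) contDiff_neg fun z ↦ by
    rw [map_neg]
    rfl

/-- **The derivative of a translation is the identity** (in the canonical trivialisation of the
tangent bundle; Huybrechts (2005), Exercise 2.2.15). Lange–Birkenhake (1992), §1.1.2.
[cite: LangeBirkenhake1992, §1.1.2] -/
theorem mfderiv_add_const {𝕜 : Type*} [NontriviallyNormedField 𝕜] [NormedSpace 𝕜 E]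
    (s x : ComplexTorus Φ) :
    mfderiv 𝓘(𝕜, E) 𝓘(𝕜, E) (fun y : ComplexTorus Φ ↦ y + s) x = ContinuousLinearMap.id 𝕜 E := by
  rw [mfderiv_of_lift (G := fun z ↦ z + Φ (lift Φ s)) (differentiable_id.add_const _)
    (fun z ↦ by rw [map_add, ContinuousLinearEquiv.symm_apply_apply, proj_add, proj_lift]) x,
    fderiv_add_const]
  exact fderiv_fun_id

end Translations

/-! ### Homomorphisms induced by integer matrices -/

section Matrix

variable [Fintype ι]

variable (Φ Φ') in
/-- **The homomorphism of tori induced by an integer matrix** `A ∈ M(ι' × ι, ℤ)` (acting on the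
lattice coordinates): `x ↦ (i' ↦ Σᵢ A i' i • xᵢ)`, well defined on `(ℝ/ℤ)^ι` because the entries
are integers. Every homomorphism `E/Λ → E'/Λ'` is of this form, `A` being its *rational
representation* (Lange–Birkenhake (1992), §1.1.2, `ρᵣ`). [cite: LangeBirkenhake1992, §1.1.2] -/
def mapMatrix (A : Matrix ι' ι ℤ) (x : ComplexTorus Φ) : ComplexTorus Φ' :=
  fun i' ↦ ∑ i, A i' i • x i

/-- The lift of `mapMatrix A` to the universal covers is the real-linear map `A_ℝ`:
`A (π x) = π' (A_ℝ x)`. [cite: LangeBirkenhake1992, §1.1.2] -/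
theorem mapMatrix_proj (A : Matrix ι' ι ℤ) (x : ι → ℝ) :
    mapMatrix Φ Φ' A (proj Φ x) = proj Φ' ((A.map (Int.cast : ℤ → ℝ)).mulVec x) := by
  funext i'
  simp only [mapMatrix, proj_apply, Matrix.mulVec, dotProduct, Matrix.map_apply]
  change _ = QuotientAddGroup.mk' (AddSubgroup.zmultiples (1 : ℝ)) (∑ i, (A i' i : ℝ) * x i)
  rw [map_sum]
  refine Finset.sum_congr rfl fun i _ ↦ ?_
  rw [← zsmul_eq_mul, map_zsmul]
  rfl

/-- `mapMatrix A` is additive. [folklore] -/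
theorem mapMatrix_add (A : Matrix ι' ι ℤ) (x y : ComplexTorus Φ) :
    mapMatrix Φ Φ' A (x + y) = mapMatrix Φ Φ' A x + mapMatrix Φ Φ' A y := by
  funext i'
  change ∑ i, A i' i • (x i + y i) = (∑ i, A i' i • x i) + ∑ i, A i' i • y i
  simp [smul_add, Finset.sum_add_distrib]

/-- The real analytic representation `Φ' ∘ A_ℝ ∘ Φ⁻¹ : E →L[ℝ] E'` of `mapMatrix A`.
[cite: LangeBirkenhake1992, §1.1.2] -/
def realRep (Φ : (ι → ℝ) ≃L[ℝ] E) (Φ' : (ι' → ℝ) ≃L[ℝ] E') (A : Matrix ι' ι ℤ) : E →L[ℝ] E' :=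
  (Φ' : (ι' → ℝ) →L[ℝ] E').comp
    ((LinearMap.toContinuousLinearMap (Matrix.mulVecLin (A.map (Int.cast : ℤ → ℝ)))).comp
      (Φ.symm : E →L[ℝ] (ι → ℝ)))

/-- `realRep A (Φ x) = Φ' (A_ℝ x)`. [folklore] -/
theorem realRep_apply (A : Matrix ι' ι ℤ) (x : ι → ℝ) :
    realRep Φ Φ' A (Φ x) = Φ' ((A.map (Int.cast : ℤ → ℝ)).mulVec x) := by
  simp [realRep]

variable [Fintype ι']

/-- **A homomorphism with `ℂ`-linear (resp. real-linear) analytic representation is holomorphic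
(resp. real `C^∞`)**: if `Φ' ∘ A_ℝ = f ∘ Φ` for a continuous `𝕜`-linear `f : E → E'`, then
`mapMatrix A` is `C^n` over `𝕜` for every `n` (its lift is `f`). Lange–Birkenhake (1992),
§1.1.2 (analytic representation `ρₐ`). [cite: LangeBirkenhake1992, §1.1.2] -/
theorem contMDiff_mapMatrix {𝕜 : Type*} [NontriviallyNormedField 𝕜] [NormedSpace 𝕜 E]
    [NormedSpace 𝕜 E'] {n : WithTop ℕ∞} {A : Matrix ι' ι ℤ} (f : E →L[𝕜] E')
    (hf : ∀ x, Φ' ((A.map (Int.cast : ℤ → ℝ)).mulVec x) = f (Φ x)) :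
    ContMDiff 𝓘(𝕜, E) 𝓘(𝕜, E') n (mapMatrix Φ Φ' A) :=
  contMDiff_of_lift (G := f) f.contDiff fun z ↦ by
    rw [mapMatrix_proj]
    conv_rhs => rw [← Φ.apply_symm_apply z, ← hf, ContinuousLinearEquiv.symm_apply_apply]

/-- **Every homomorphism `mapMatrix A` is a real `C^∞` map** (its lift is the real-linear
`Φ' ∘ A_ℝ ∘ Φ⁻¹`). Lange–Birkenhake (1992), §1.1.2. [cite: LangeBirkenhake1992, §1.1.2] -/
theorem contMDiff_real_mapMatrix {n : WithTop ℕ∞} (A : Matrix ι' ι ℤ) :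
    ContMDiff 𝓘(ℝ, E) 𝓘(ℝ, E') n (mapMatrix Φ Φ' A) :=
  contMDiff_mapMatrix (realRep Φ Φ' A) fun x ↦ (realRep_apply A x).symm

/-- **The derivative of the homomorphism `mapMatrix A` is its real analytic representation**
`Φ' ∘ A_ℝ ∘ Φ⁻¹` at every point (in the canonical trivialisations). Lange–Birkenhake (1992),
§1.1.2 (`ρₐ(f)` is the differential of `f`). [cite: LangeBirkenhake1992, §1.1.2] -/
theorem mfderiv_mapMatrix (A : Matrix ι' ι ℤ) (x : ComplexTorus Φ) :
    mfderiv 𝓘(ℝ, E) 𝓘(ℝ, E') (mapMatrix Φ Φ' A) x = realRep Φ Φ' A := by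
  rw [mfderiv_of_lift (G := realRep Φ Φ' A) (realRep Φ Φ' A).differentiable (fun z ↦ by
    rw [mapMatrix_proj]
    conv_rhs => rw [← Φ.apply_symm_apply z, realRep_apply, ContinuousLinearEquiv.symm_apply_apply]) x,
    ContinuousLinearMap.fderiv]

end Matrix

end ComplexTorus

end Literature.Geometry.Kaehler
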